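import Summits.QuantumFields.YangMills.Theorems.UnitScaleTiltProp8FlatOpsLettersAssembly
import HarnessLib

/-!
# Route `UnitScaleTilt`, crux K1 child «MinimiserStabilityRegPr» (stmt-QuantumFields-19200), v8 pillar **P2 `stub_flatOpsCubeSeq`** — OWNER RULING g21-№4 §B3(a),
# file 3 of the P2 assembly: **THE `H`-ROWS OF `FlatOpsLettersAssembly.RowsAt` FROM KERNEL ROWS OF THE SHAPE OF [Balaban1984PropagatorsII] COR. 2.8 (2.150)–(2.151)**
# (the port's `B6Cor28EntriesKLevelV1.cor28_kLevel_H_DH`: `|(He_c)(b)| ≤ C·e^{−δ₅d(b,c)}`, `(L^{j(b)}η)|∇^η(He_c)(b)| ≤ C·e^{−δ₅d(b,c)}` — level-free constants)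
# **AND [Balaban1985Variational] (130)/(139)–(140) (second order), BY LINEARITY AND THE (162) ROW SUM**

Cell `ym3-torus` (HUMAN RULING D-0037, YM ladder rung R3), seat `ym3-torus-p1` gen 16.  `--supports stmt-QuantumFields-19200 --as helper`; count-neutral.

THE PRINT.  [Balaban1984PropagatorsII] Cor. 2.8 p. 249: *«|H(b,c)|, |(∇H)(b,c)| ≦ O(1)[1, (Lʲη)⁻¹](L^{j′}η)^{−d}e^{−δ₅d(y,c₋)}, b ∈ Δ(y), y ∈ Λ_j, c₋ ∈ Λ_{j′}»* (with the
(2.150) volume weight `(L^{j′}η)^d` of the flat entry this is `|H(b,c)| ≤ O(1)e^{−δ₅d}`, `(Lʲη)|∇^ηH(b,c)| ≤ O(1)e^{−δ₅d}` — the tree's `cor28_kLevel_H_DH` shape);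
[Balaban1985Variational] (130) p. 298: *«|(Δ_{U₀}H₀)(x, y′)| ≦ B₀(Lʲη)^{−3}(L^{j′}η)^{−d}e^{−δ₀d(y,y′)}»* (`H₀ = H∘diag((L^{j(c)}η)⁻¹)`), (139)–(140) p. 299 (the `D*D` row);
(161)₁ p. 303: *«|HB|, |∇^ηHB|, |∂^{η*}∂^ηHB|, |Δ^ηHB| ≦ B₀Σ_{c∈ℭ_k}e^{−δ₀d(y₁,c₋)}(L^{j(c)}η)⁻¹|B(c)|»* = the kernel rows summed against the data (linearity);
(46) p. 285 *«|HB| ≦ B₀(Lʲη)⁻¹|B|, |∇HB| ≦ B₀(Lʲη)⁻²|B| on Ω_j»* = the kernel rows summed with (162) p. 303 *«Σ_c e^{−½δ₀d}(d+1)(L^{j(c)}η)⁻¹ ≦ B₃»*.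

WHAT IS PROVED (sorry-free; axioms standard).  For EVERY nested family `D` at the carrier, level weights `w` (`IsLevWeight`, `D.k = K − n`), a distance `dBI` and a
plain-function `H`:
* §1 `apply_eq_sum_indicator` — linearity: `(HX)(b) = Σ_c X(c)·(He_c)(b)` for any family of indicator vectors `e_c` (no decidability in the statements: an
  «indicator» is `e c = 1 ∧ e c′ = 0 (c′ ≠ c)`);
* §2 **`HKernelRows F n K D dBI w H C δ`** — THE FOUR KERNEL ROWS (named schema): (k1) `|(He_c)(b)| ≤ C·e^{−δ·dBI(b,c)}` ((2.151)₁ verbatim), (k2)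
  `(L^{j(b)}η)·η⁻¹·|(He_c)(b+e_ν) − (He_c)(b)| ≤ C·e^{−δ·dBI(b,c)}` ((2.151)₂ verbatim), (k3) `(L^{j(b)}η)³·|(∂^{η*}∂^η He_c)(b)| ≤ C·e^{−δ·dBI(b,c)}` ((139)–(140) in
  kernel form, C-B11-F1), (k4) `(L^{j(b)}η)²·η⁻²·|(Δ He_c)(b)| ≤ C·e^{−δ·dBI(b,c)}` ((130) composed with the level separation (2.60): print's right side carries
  `(L^{j(c)}η)` instead of one factor `(L^{j(b)}η)`);
* §3 **`hDecayLetterD_of_kernelRows`**: `HKernelRows … C δ ⇒ HDecayLetterD … C δ` (linearity, `(L^{j(b)}η) ≤ 1`);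
  **`hSupLetterG_of_kernelRows`**, **`hLapLetterG_of_kernelRows`**: `HKernelRows … C δ` + `RowSum162 … δ₀ B₃` (`δ ≥ δ₀/2`, `dBI ≥ 0`) ⇒ `HSupLetterG … (C·B₃)` (46) and
  `HLapLetterG … (C·B₃)` (130) — the data size `(L^{j(c)}η)|X(c)| ≤ t` turns each kernel row into `C·t·(L^{j(b)}η)·Σ_c e^{−δd}L^{k−j(c)} ≤ C·t·B₃`;
* §4 **`hRows_of_kernelRows`** — the whole `H`-part of `RowsAt` (its first conjunct) from `HKernelRows` for the canonical `flatH` + `RowSum162` + the comparator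
  `distBI ≤ dBI`, constants `(max C (C·B₃), δ, B₃)`.
So after this file the `H`-side of P2 = {(2.151)₁,₂ for the canonical `H` of the family = the port's `cor28_kLevel_H_DH` row shape (gap G-F3′-L0: families WITH level 0,
at the carrier), the two second-order kernel rows (C-B11-F1 / (130)), a distance `dBI ≥ distBI` with (162)}.  HONEST SCOPE: finite sums and linearity; no estimate proved;
NOT a claim about the mass gap.

References: T. Bałaban, CMP **96** (1984) 223–250 [Balaban1984PropagatorsII] Cor. 2.8 (2.150)–(2.151) p.249, Lemma 2.1 (2.60)–(2.63) p.234; CMP **102** (1985) 277–309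
[Balaban1985Variational] (46) p.285, (130) p.298, (139)–(140) p.299, (161)–(162) p.303.
-/

set_option autoImplicit false

noncomputable section

open scoped BigOperators

namespace Summit.QuantumFields.YangMills.Theorems.FlatOpsHRowsFromKernels

open Literature.MathematicalPhysics.QuantumFieldTheory.Balaban1983to89
open B6SectADomainsV1 (Domains)
open B6SectAOperatorsV1 (BondIdx dcE dcsE)
open B11Eq115Space (levOf)
open T3ContinuumYM3Torus (T3Family)
open FlatCubeOpsText (distBI IsLevWeight HSupLetterG HDecayLetterD RowSum162)
open FlatOpsLettersAssembly (flatH HLapLetterG)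

/-! ## §1 Linearity against indicator vectors -/

section Generic

variable {ι κ : Type*}

/-- **LINEARITY**: `(HX)(b) = Σ_c X(c)·(He_c)(b)` for any family `e_c` of indicator vectors (`e_c(c) = 1`, `e_c(c′) = 0` for `c′ ≠ c`). [folklore] -/
theorem apply_eq_sum_indicator [Fintype ι] (H : (ι → ℝ) →ₗ[ℝ] (κ → ℝ)) (e : ι → ι → ℝ) (he : ∀ c, e c c = 1) (he' : ∀ c c', c' ≠ c → e c c' = 0)
    (X : ι → ℝ) (b : κ) : H X b = ∑ c, X c * H (e c) b := by
  have hX : X = ∑ c, X c • e c := by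
    funext j
    rw [Finset.sum_apply, Finset.sum_eq_single j]
    · simp [he j]
    · intro c _ hcj
      simp [he' c j (Ne.symm hcj)]
    · intro h
      exact absurd (Finset.mem_univ j) h
  conv_lhs => rw [hX]
  rw [map_sum, Finset.sum_apply]
  refine Finset.sum_congr rfl fun c _ => ?_
  rw [map_smul, Pi.smul_apply, smul_eq_mul]

/-- an indicator family exists (classically: `Pi.single`). [folklore] -/
theorem exists_indicator : ∃ e : ι → ι → ℝ, (∀ c, e c c = 1) ∧ ∀ c c', c' ≠ c → e c c' = 0 := by
  classical
  exact ⟨fun c => Pi.single c 1, fun c => Pi.single_eq_same c 1, fun c c' h => Pi.single_eq_of_ne h 1⟩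

end Generic

/-! ## §2 The four kernel rows of `H` -/

section Rows

variable (F : T3Family) (n K : ℕ) (D : Domains (F.P K))

/-- **THE KERNEL ROWS OF `H` OVER A DISTANCE `dBI`** (entries of `H` against indicator data `e_c` at the index bond `c`, read at the fine bond `b`):
(k1) `|(He_c)(b)| ≤ C·e^{−δ·dBI(b,c)}` and (k2) `(L^{j(b)}η)·η⁻¹·|(He_c)(b+e_ν) − (He_c)(b)| ≤ C·e^{−δ·dBI(b,c)}` = [Balaban1984PropagatorsII] (2.151)₁,₂ with the (2.150)
volume weight (the port's `cor28_kLevel_H_DH` shape, level-free `C`); (k3) `(L^{j(b)}η)³·|(∂^{η*}∂^ηHe_c)(b)| ≤ C·e^{−δ·dBI(b,c)}` ([Balaban1985Variational] (139)–(140), kernel form);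
(k4) `(L^{j(b)}η)²·η⁻²·|(ΔHe_c)(b)| ≤ C·e^{−δ·dBI(b,c)}` ((130) ∘ (2.60)).  Weights `w m b = (L^{j(b)}η)^m`.
[cite: Balaban1984PropagatorsII, Cor. 2.8 (2.150)-(2.151) p.249; Balaban1985Variational, (130) p.298, (139)-(140) p.299] -/
def HKernelRows (dBI : PBond (F.P K) 0 → BondIdx D → ℝ) (w : ℕ → PBond (F.P K) 0 → ℝ) (H : (BondIdx D → ℝ) →ₗ[ℝ] (PBond (F.P K) 0 → ℝ))
    (C δ : ℝ) : Prop :=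
  ∀ (c : BondIdx D) (e : BondIdx D → ℝ), e c = 1 → (∀ c', c' ≠ c → e c' = 0) → ∀ b : PBond (F.P K) 0,
    |H e b| ≤ C * Real.exp (-(δ * dBI b c)) ∧
    (∀ ν : Fin 3, w 1 b * (F.L : ℝ) ^ (K - n) * |H e ⟨b.src.shift ν, b.dir⟩ - H e b| ≤ C * Real.exp (-(δ * dBI b c))) ∧
    w 3 b * |(dcsE ((F.L : ℝ) ^ (K - n)) (dcE ((F.L : ℝ) ^ (K - n)) (WithLp.toLp 2 (H e)))) b| ≤ C * Real.exp (-(δ * dBI b c)) ∧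
    w 2 b * ((F.L : ℝ) ^ (K - n)) ^ 2 * |∑ ν : Fin 3, ((H e b - H e ⟨b.src.shift ν, b.dir⟩) + (H e b - H e ⟨b.src.unshift ν, b.dir⟩))| ≤
      C * Real.exp (-(δ * dBI b c))

end Rows

/-! ## §3 From kernel rows to the letters of the text -/

section Derive

variable {F : T3Family} {n K : ℕ} {D : Domains (F.P K)} {w : ℕ → PBond (F.P K) 0 → ℝ}
variable {dBI : PBond (F.P K) 0 → BondIdx D → ℝ} {H : (BondIdx D → ℝ) →ₗ[ℝ] (PBond (F.P K) 0 → ℝ)} {C δ : ℝ}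

/-- the level base `β(b) = L^{j(b)}·L^{−(K−n)}` of the weights: `w m b = β(b)^m`, `0 ≤ β(b) ≤ 1` (as `j(b) ≤ K − n`). [cite: Balaban1985Variational, p.286, (115) p.294] -/
theorem levBase_bounds (hw : IsLevWeight F n K D w) (b : PBond (F.P K) 0) :
    0 ≤ w 1 b ∧ w 1 b ≤ 1 ∧ w 2 b = w 1 b * w 1 b ∧ w 3 b = w 1 b * w 2 b := by
  have hL1 : (1 : ℝ) ≤ (F.L : ℝ) := by exact_mod_cast F.hL.2.le
  have hL0 : (0 : ℝ) < (F.L : ℝ) := lt_of_lt_of_le zero_lt_one hL1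
  have hlev : levOf (fun j => {x : Site (F.P K) 0 | D.InOm j x}) (K - n) b.src ≤ K - n := B11Eq115Space.levOf_le _ _ _
  refine ⟨?_, ?_, ?_, ?_⟩
  · rw [hw 1 b]; positivity
  · rw [hw 1 b, pow_one, inv_pow, ← div_eq_mul_inv, div_le_one (pow_pos hL0 _)]
    exact pow_le_pow_right₀ hL1 hlev
  · rw [hw 2 b, hw 1 b]; ring
  · rw [hw 3 b, hw 1 b, hw 2 b]; ring

/-- the data size `(L^{j(c)}η)|X(c)| ≤ t` in the form `|X(c)| ≤ t·L^{(K−n)−j(c)}`. [cite: Balaban1985Variational, (46) p.285, (162) p.303] -/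
theorem abs_data_le (hDk : D.k = K - n) {X : BondIdx D → ℝ} {t : ℝ}
    (hX : ∀ c, ((F.L : ℝ) ^ ((c.1.1 : ℕ)) * ((F.L : ℝ)⁻¹) ^ (K - n)) * |X c| ≤ t) (c : BondIdx D) :
    |X c| ≤ t * (F.L : ℝ) ^ ((K - n) - (c.1.1 : ℕ)) := by
  have hL0 : (0 : ℝ) < (F.L : ℝ) := by exact_mod_cast lt_trans zero_lt_one F.hL.2
  have hjc : (c.1.1 : ℕ) ≤ K - n := by
    have := Nat.lt_succ_iff.1 c.1.1.isLt
    omega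
  have hωpos : 0 < (F.L : ℝ) ^ ((c.1.1 : ℕ)) * ((F.L : ℝ)⁻¹) ^ (K - n) := by positivity
  have hω : (F.L : ℝ) ^ ((c.1.1 : ℕ)) * ((F.L : ℝ)⁻¹) ^ (K - n) * (F.L : ℝ) ^ ((K - n) - (c.1.1 : ℕ)) = 1 := by
    rw [inv_pow, pow_sub₀ _ hL0.ne' hjc]
    field_simp
  have h := hX c
  calc |X c| = ((F.L : ℝ) ^ ((c.1.1 : ℕ)) * ((F.L : ℝ)⁻¹) ^ (K - n) * |X c|) * (F.L : ℝ) ^ ((K - n) - (c.1.1 : ℕ)) := by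
        rw [mul_comm _ |X c|, mul_assoc, hω, mul_one]
    _ ≤ t * (F.L : ℝ) ^ ((K - n) - (c.1.1 : ℕ)) := mul_le_mul_of_nonneg_right h (pow_nonneg hL0.le _)

/-- a kernel decaying at rate `δ ≥ δ₀/2` is dominated by the (162) summand `e^{−½δ₀d}(d + 1)` (`d ≥ 0`). [cite: Balaban1985Variational, (162)-(163) p.303] -/
theorem exp_le_rowSummand {δ₀ d : ℝ} (hδ : δ₀ / 2 ≤ δ) (hd : 0 ≤ d) :
    Real.exp (-(δ * d)) ≤ Real.exp (-(δ₀ / 2 * d)) * (d + 1) := by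
  have h1 : Real.exp (-(δ * d)) ≤ Real.exp (-(δ₀ / 2 * d)) :=
    Real.exp_le_exp.2 (neg_le_neg (mul_le_mul_of_nonneg_right hδ hd))
  calc Real.exp (-(δ * d)) ≤ Real.exp (-(δ₀ / 2 * d)) * 1 := by rw [mul_one]; exact h1
    _ ≤ Real.exp (-(δ₀ / 2 * d)) * (d + 1) := mul_le_mul_of_nonneg_left (by linarith) (Real.exp_pos _).le

/-- **(161)₁ FROM THE KERNEL ROWS** (linearity: `HX = Σ_c X(c)·He_c`; the left weights `(L^{j(b)}η)^m ≤ 1` absorb the extra powers).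
[cite: Balaban1985Variational, (161) p.303; Balaban1984PropagatorsII, Cor. 2.8 (2.150)-(2.151) p.249] -/
theorem hDecayLetterD_of_kernelRows (hw : IsLevWeight F n K D w) (hk : HKernelRows F n K D dBI w H C δ) :
    HDecayLetterD F n K D dBI w H C δ := by
  intro X b
  obtain ⟨e, he, he'⟩ := exists_indicator (ι := BondIdx D)
  obtain ⟨hw0, hw1, hw2, hw3⟩ := levBase_bounds hw b
  have hE : ∀ b', H X b' = ∑ c, X c * H (e c) b' := fun b' => apply_eq_sum_indicator H e he he' X b'
  have hrow : ∀ c, 0 ≤ Real.exp (-(δ * dBI b c)) * |X c| := fun c => mul_nonneg (Real.exp_pos _).le (abs_nonneg _)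
  refine ⟨?_, fun ν => ?_, ?_, ?_⟩
  · -- row 1
    calc w 1 b * |H X b| ≤ 1 * |H X b| := mul_le_mul_of_nonneg_right hw1 (abs_nonneg _)
      _ = |∑ c, X c * H (e c) b| := by rw [one_mul, hE b]
      _ ≤ ∑ c, |X c * H (e c) b| := Finset.abs_sum_le_sum_abs _ _
      _ ≤ ∑ c, |X c| * (C * Real.exp (-(δ * dBI b c))) := Finset.sum_le_sum fun c _ => by
          rw [abs_mul]; exact mul_le_mul_of_nonneg_left ((hk c (e c) (he c) (he' c) b).1) (abs_nonneg _)
      _ = C * ∑ c, Real.exp (-(δ * dBI b c)) * |X c| := by rw [Finset.mul_sum]; exact Finset.sum_congr rfl fun c _ => by ring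
  · -- row 2
    have hdiff : H X ⟨b.src.shift ν, b.dir⟩ - H X b = ∑ c, X c * (H (e c) ⟨b.src.shift ν, b.dir⟩ - H (e c) b) := by
      rw [hE, hE, ← Finset.sum_sub_distrib]
      exact Finset.sum_congr rfl fun c _ => by ring
    rw [hdiff, hw2]
    calc w 1 b * w 1 b * (F.L : ℝ) ^ (K - n) * |∑ c, X c * (H (e c) ⟨b.src.shift ν, b.dir⟩ - H (e c) b)|
        ≤ w 1 b * w 1 b * (F.L : ℝ) ^ (K - n) * ∑ c, |X c * (H (e c) ⟨b.src.shift ν, b.dir⟩ - H (e c) b)| :=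
          mul_le_mul_of_nonneg_left (Finset.abs_sum_le_sum_abs _ _) (by positivity)
      _ = w 1 b * ∑ c, |X c| * (w 1 b * (F.L : ℝ) ^ (K - n) * |H (e c) ⟨b.src.shift ν, b.dir⟩ - H (e c) b|) := by
          rw [Finset.mul_sum, Finset.mul_sum]
          exact Finset.sum_congr rfl fun c _ => by rw [abs_mul]; ring
      _ ≤ 1 * ∑ c, |X c| * (C * Real.exp (-(δ * dBI b c))) := by
          refine mul_le_mul hw1 (Finset.sum_le_sum fun c _ => ?_) (Finset.sum_nonneg fun c _ => by positivity) zero_le_one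
          exact mul_le_mul_of_nonneg_left ((hk c (e c) (he c) (he' c) b).2.1 ν) (abs_nonneg _)
      _ = C * ∑ c, Real.exp (-(δ * dBI b c)) * |X c| := by rw [one_mul, Finset.mul_sum]; exact Finset.sum_congr rfl fun c _ => by ring
  · -- row 3: `X ↦ (∂*∂ (HX))(b)` is linear; expand it against the indicators
    set T : (BondIdx D → ℝ) →ₗ[ℝ] (PBond (F.P K) 0 → ℝ) :=
      (WithLp.linearEquiv 2 ℝ (PBond (F.P K) 0 → ℝ)).toLinearMap ∘ₗ
        (dcsE (P := F.P K) ((F.L : ℝ) ^ (K - n)) ∘ₗ dcE (P := F.P K) ((F.L : ℝ) ^ (K - n))) ∘ₗ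
        (WithLp.linearEquiv 2 ℝ (PBond (F.P K) 0 → ℝ)).symm.toLinearMap ∘ₗ H with hT
    have hTapp : ∀ (Y : BondIdx D → ℝ) (b' : PBond (F.P K) 0),
        (dcsE ((F.L : ℝ) ^ (K - n)) (dcE ((F.L : ℝ) ^ (K - n)) (WithLp.toLp 2 (H Y)))) b' = T Y b' := fun _ _ => rfl
    rw [hTapp, apply_eq_sum_indicator T e he he' X b]
    calc w 3 b * |∑ c, X c * T (e c) b| ≤ w 3 b * ∑ c, |X c * T (e c) b| :=
          mul_le_mul_of_nonneg_left (Finset.abs_sum_le_sum_abs _ _) (by rw [hw3, hw2]; positivity)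
      _ = ∑ c, |X c| * (w 3 b * |T (e c) b|) := by rw [Finset.mul_sum]; exact Finset.sum_congr rfl fun c _ => by rw [abs_mul]; ring
      _ ≤ ∑ c, |X c| * (C * Real.exp (-(δ * dBI b c))) := Finset.sum_le_sum fun c _ => by
          refine mul_le_mul_of_nonneg_left ?_ (abs_nonneg _)
          have h3 := (hk c (e c) (he c) (he' c) b).2.2.1
          rwa [hTapp] at h3
      _ = C * ∑ c, Real.exp (-(δ * dBI b c)) * |X c| := by rw [Finset.mul_sum]; exact Finset.sum_congr rfl fun c _ => by ring
  · -- row 4: the Laplacian stencil is linear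
    have hlap : ∑ ν : Fin 3, ((H X b - H X ⟨b.src.shift ν, b.dir⟩) + (H X b - H X ⟨b.src.unshift ν, b.dir⟩)) =
        ∑ c, X c * ∑ ν : Fin 3, ((H (e c) b - H (e c) ⟨b.src.shift ν, b.dir⟩) + (H (e c) b - H (e c) ⟨b.src.unshift ν, b.dir⟩)) := by
      simp only [hE, Finset.mul_sum, ← Finset.sum_sub_distrib, ← Finset.sum_add_distrib, ← mul_sub, ← mul_add]
      rw [Finset.sum_comm]
    rw [hlap, hw3]
    calc w 1 b * w 2 b * ((F.L : ℝ) ^ (K - n)) ^ 2 *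
          |∑ c, X c * ∑ ν : Fin 3, ((H (e c) b - H (e c) ⟨b.src.shift ν, b.dir⟩) + (H (e c) b - H (e c) ⟨b.src.unshift ν, b.dir⟩))|
        ≤ w 1 b * w 2 b * ((F.L : ℝ) ^ (K - n)) ^ 2 *
          ∑ c, |X c * ∑ ν : Fin 3, ((H (e c) b - H (e c) ⟨b.src.shift ν, b.dir⟩) + (H (e c) b - H (e c) ⟨b.src.unshift ν, b.dir⟩))| :=
          mul_le_mul_of_nonneg_left (Finset.abs_sum_le_sum_abs _ _) (by rw [hw2]; positivity)
      _ = w 1 b * ∑ c, |X c| * (w 2 b * ((F.L : ℝ) ^ (K - n)) ^ 2 *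
          |∑ ν : Fin 3, ((H (e c) b - H (e c) ⟨b.src.shift ν, b.dir⟩) + (H (e c) b - H (e c) ⟨b.src.unshift ν, b.dir⟩))|) := by
          rw [Finset.mul_sum, Finset.mul_sum]
          exact Finset.sum_congr rfl fun c _ => by rw [abs_mul]; ring
      _ ≤ 1 * ∑ c, |X c| * (C * Real.exp (-(δ * dBI b c))) := by
          refine mul_le_mul hw1 (Finset.sum_le_sum fun c _ => ?_) (Finset.sum_nonneg fun c _ => by rw [hw2]; positivity) zero_le_one
          exact mul_le_mul_of_nonneg_left ((hk c (e c) (he c) (he' c) b).2.2.2) (abs_nonneg _)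
      _ = C * ∑ c, Real.exp (-(δ * dBI b c)) * |X c| := by rw [one_mul, Finset.mul_sum]; exact Finset.sum_congr rfl fun c _ => by ring

/-- **(46) FROM THE KERNEL ROWS AND (162)**: with data `(L^{j(c)}η)|X(c)| ≤ t` each kernel row gives `C·t·(L^{j(b)}η)·Σ_c e^{−δd}L^{(K−n)−j(c)}`, and the (162) row sum
(`RowSum162`, rate `δ₀/2 ≤ δ`, `dBI ≥ 0`) bounds that by `C·t·B₃`. [cite: Balaban1985Variational, (46) p.285, (162) p.303; Balaban1984PropagatorsII, Cor. 2.8 (2.150)-(2.151) p.249] -/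
theorem hSupLetterG_of_kernelRows (hw : IsLevWeight F n K D w) (hDk : D.k = K - n) (hC : 0 ≤ C) {δ₀ B₃ : ℝ} (hδ : δ₀ / 2 ≤ δ)
    (hd0 : ∀ b c, 0 ≤ dBI b c) (hk : HKernelRows F n K D dBI w H C δ) (hrow : RowSum162 F n K D dBI w δ₀ B₃) :
    HSupLetterG F n K D w H (C * B₃) := by
  intro X t ht hX
  obtain ⟨e, he, he'⟩ := exists_indicator (ι := BondIdx D)
  have hE : ∀ b', H X b' = ∑ c, X c * H (e c) b' := fun b' => apply_eq_sum_indicator H e he he' X b'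
  have hXc : ∀ c, |X c| ≤ t * (F.L : ℝ) ^ ((K - n) - (c.1.1 : ℕ)) := abs_data_le hDk hX
  have hL0 : (0 : ℝ) ≤ (F.L : ℝ) := Nat.cast_nonneg _
  -- the per-term bound `|X c|·C·e^{−δd} ≤ C·t·(e^{−½δ₀d}(d+1)L^{(K−n)−j(c)})`
  have hterm : ∀ b c, |X c| * (C * Real.exp (-(δ * dBI b c))) ≤
      C * t * (Real.exp (-(δ₀ / 2 * dBI b c)) * (dBI b c + 1) * (F.L : ℝ) ^ ((K - n) - (c.1.1 : ℕ))) := by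
    intro b c
    calc |X c| * (C * Real.exp (-(δ * dBI b c)))
        ≤ (t * (F.L : ℝ) ^ ((K - n) - (c.1.1 : ℕ))) * (C * (Real.exp (-(δ₀ / 2 * dBI b c)) * (dBI b c + 1))) :=
          mul_le_mul (hXc c) (mul_le_mul_of_nonneg_left (exp_le_rowSummand hδ (hd0 b c)) hC) (by positivity) (by positivity)
      _ = C * t * (Real.exp (-(δ₀ / 2 * dBI b c)) * (dBI b c + 1) * (F.L : ℝ) ^ ((K - n) - (c.1.1 : ℕ))) := by ring
  refine ⟨fun b => ?_, fun b ν => ?_⟩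
  · obtain ⟨hw0, hw1, -, -⟩ := levBase_bounds hw b
    calc w 1 b * |H X b| = w 1 b * |∑ c, X c * H (e c) b| := by rw [hE b]
      _ ≤ w 1 b * ∑ c, |X c * H (e c) b| := mul_le_mul_of_nonneg_left (Finset.abs_sum_le_sum_abs _ _) hw0
      _ ≤ w 1 b * ∑ c, |X c| * (C * Real.exp (-(δ * dBI b c))) := mul_le_mul_of_nonneg_left
          (Finset.sum_le_sum fun c _ => by
            rw [abs_mul]; exact mul_le_mul_of_nonneg_left ((hk c (e c) (he c) (he' c) b).1) (abs_nonneg _)) hw0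
      _ ≤ w 1 b * ∑ c, C * t * (Real.exp (-(δ₀ / 2 * dBI b c)) * (dBI b c + 1) * (F.L : ℝ) ^ ((K - n) - (c.1.1 : ℕ))) :=
          mul_le_mul_of_nonneg_left (Finset.sum_le_sum fun c _ => hterm b c) hw0
      _ = C * t * (w 1 b * ∑ c, Real.exp (-(δ₀ / 2 * dBI b c)) * (dBI b c + 1) * (F.L : ℝ) ^ ((K - n) - (c.1.1 : ℕ))) := by
          rw [← Finset.mul_sum]; ring
      _ ≤ C * t * B₃ := mul_le_mul_of_nonneg_left (hrow b) (mul_nonneg hC ht)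
      _ = C * B₃ * t := by ring
  · obtain ⟨hw0, hw1, hw2, -⟩ := levBase_bounds hw b
    have hdiff : H X ⟨b.src.shift ν, b.dir⟩ - H X b = ∑ c, X c * (H (e c) ⟨b.src.shift ν, b.dir⟩ - H (e c) b) := by
      rw [hE, hE, ← Finset.sum_sub_distrib]
      exact Finset.sum_congr rfl fun c _ => by ring
    rw [hdiff, hw2]
    calc w 1 b * w 1 b * (F.L : ℝ) ^ (K - n) * |∑ c, X c * (H (e c) ⟨b.src.shift ν, b.dir⟩ - H (e c) b)|
        ≤ w 1 b * w 1 b * (F.L : ℝ) ^ (K - n) * ∑ c, |X c * (H (e c) ⟨b.src.shift ν, b.dir⟩ - H (e c) b)| :=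
          mul_le_mul_of_nonneg_left (Finset.abs_sum_le_sum_abs _ _) (by positivity)
      _ = w 1 b * ∑ c, |X c| * (w 1 b * (F.L : ℝ) ^ (K - n) * |H (e c) ⟨b.src.shift ν, b.dir⟩ - H (e c) b|) := by
          rw [Finset.mul_sum, Finset.mul_sum]
          exact Finset.sum_congr rfl fun c _ => by rw [abs_mul]; ring
      _ ≤ w 1 b * ∑ c, |X c| * (C * Real.exp (-(δ * dBI b c))) := mul_le_mul_of_nonneg_left
          (Finset.sum_le_sum fun c _ => mul_le_mul_of_nonneg_left ((hk c (e c) (he c) (he' c) b).2.1 ν) (abs_nonneg _)) hw0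
      _ ≤ w 1 b * ∑ c, C * t * (Real.exp (-(δ₀ / 2 * dBI b c)) * (dBI b c + 1) * (F.L : ℝ) ^ ((K - n) - (c.1.1 : ℕ))) :=
          mul_le_mul_of_nonneg_left (Finset.sum_le_sum fun c _ => hterm b c) hw0
      _ = C * t * (w 1 b * ∑ c, Real.exp (-(δ₀ / 2 * dBI b c)) * (dBI b c + 1) * (F.L : ℝ) ^ ((K - n) - (c.1.1 : ℕ))) := by
          rw [← Finset.mul_sum]; ring
      _ ≤ C * t * B₃ := mul_le_mul_of_nonneg_left (hrow b) (mul_nonneg hC ht)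
      _ = C * B₃ * t := by ring

/-- **(130) — THE LAPLACIAN SUP ROW — FROM THE KERNEL ROW (k4) AND (162)**. [cite: Balaban1985Variational, (130) p.298, (162) p.303] -/
theorem hLapLetterG_of_kernelRows (hw : IsLevWeight F n K D w) (hDk : D.k = K - n) (hC : 0 ≤ C) {δ₀ B₃ : ℝ} (hδ : δ₀ / 2 ≤ δ)
    (hd0 : ∀ b c, 0 ≤ dBI b c) (hk : HKernelRows F n K D dBI w H C δ) (hrow : RowSum162 F n K D dBI w δ₀ B₃) :
    HLapLetterG F n K D w H (C * B₃) := by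
  intro X t ht hX b
  obtain ⟨e, he, he'⟩ := exists_indicator (ι := BondIdx D)
  have hE : ∀ b', H X b' = ∑ c, X c * H (e c) b' := fun b' => apply_eq_sum_indicator H e he he' X b'
  have hXc : ∀ c, |X c| ≤ t * (F.L : ℝ) ^ ((K - n) - (c.1.1 : ℕ)) := abs_data_le hDk hX
  have hL0 : (0 : ℝ) ≤ (F.L : ℝ) := Nat.cast_nonneg _
  obtain ⟨hw0, hw1, hw2, hw3⟩ := levBase_bounds hw b
  have hterm : ∀ c, |X c| * (C * Real.exp (-(δ * dBI b c))) ≤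
      C * t * (Real.exp (-(δ₀ / 2 * dBI b c)) * (dBI b c + 1) * (F.L : ℝ) ^ ((K - n) - (c.1.1 : ℕ))) := by
    intro c
    calc |X c| * (C * Real.exp (-(δ * dBI b c)))
        ≤ (t * (F.L : ℝ) ^ ((K - n) - (c.1.1 : ℕ))) * (C * (Real.exp (-(δ₀ / 2 * dBI b c)) * (dBI b c + 1))) :=
          mul_le_mul (hXc c) (mul_le_mul_of_nonneg_left (exp_le_rowSummand hδ (hd0 b c)) hC) (by positivity) (by positivity)
      _ = C * t * (Real.exp (-(δ₀ / 2 * dBI b c)) * (dBI b c + 1) * (F.L : ℝ) ^ ((K - n) - (c.1.1 : ℕ))) := by ring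
  have hlap : ∑ ν : Fin 3, ((H X b - H X ⟨b.src.shift ν, b.dir⟩) + (H X b - H X ⟨b.src.unshift ν, b.dir⟩)) =
      ∑ c, X c * ∑ ν : Fin 3, ((H (e c) b - H (e c) ⟨b.src.shift ν, b.dir⟩) + (H (e c) b - H (e c) ⟨b.src.unshift ν, b.dir⟩)) := by
    simp only [hE, Finset.mul_sum, ← Finset.sum_sub_distrib, ← Finset.sum_add_distrib, ← mul_sub, ← mul_add]
    rw [Finset.sum_comm]
  rw [hlap, hw3]
  calc w 1 b * w 2 b * ((F.L : ℝ) ^ (K - n)) ^ 2 *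
        |∑ c, X c * ∑ ν : Fin 3, ((H (e c) b - H (e c) ⟨b.src.shift ν, b.dir⟩) + (H (e c) b - H (e c) ⟨b.src.unshift ν, b.dir⟩))|
      ≤ w 1 b * w 2 b * ((F.L : ℝ) ^ (K - n)) ^ 2 *
        ∑ c, |X c * ∑ ν : Fin 3, ((H (e c) b - H (e c) ⟨b.src.shift ν, b.dir⟩) + (H (e c) b - H (e c) ⟨b.src.unshift ν, b.dir⟩))| :=
        mul_le_mul_of_nonneg_left (Finset.abs_sum_le_sum_abs _ _) (by rw [hw2]; positivity)
    _ = w 1 b * ∑ c, |X c| * (w 2 b * ((F.L : ℝ) ^ (K - n)) ^ 2 *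
        |∑ ν : Fin 3, ((H (e c) b - H (e c) ⟨b.src.shift ν, b.dir⟩) + (H (e c) b - H (e c) ⟨b.src.unshift ν, b.dir⟩))|) := by
        rw [Finset.mul_sum, Finset.mul_sum]
        exact Finset.sum_congr rfl fun c _ => by rw [abs_mul]; ring
    _ ≤ w 1 b * ∑ c, |X c| * (C * Real.exp (-(δ * dBI b c))) := mul_le_mul_of_nonneg_left
        (Finset.sum_le_sum fun c _ => mul_le_mul_of_nonneg_left ((hk c (e c) (he c) (he' c) b).2.2.2) (abs_nonneg _)) hw0
    _ ≤ w 1 b * ∑ c, C * t * (Real.exp (-(δ₀ / 2 * dBI b c)) * (dBI b c + 1) * (F.L : ℝ) ^ ((K - n) - (c.1.1 : ℕ))) :=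
        mul_le_mul_of_nonneg_left (Finset.sum_le_sum fun c _ => hterm c) hw0
    _ = C * t * (w 1 b * ∑ c, Real.exp (-(δ₀ / 2 * dBI b c)) * (dBI b c + 1) * (F.L : ℝ) ^ ((K - n) - (c.1.1 : ℕ))) := by
        rw [← Finset.mul_sum]; ring
    _ ≤ C * t * B₃ := mul_le_mul_of_nonneg_left (hrow b) (mul_nonneg hC ht)
    _ = C * B₃ * t := by ring

end Derive

/-! ## §4 The `H`-part of `RowsAt` from the kernel rows of the canonical `flatH` -/

section Pack

variable {F : T3Family} {n K : ℕ} {D : Domains (F.P K)} {w : ℕ → PBond (F.P K) 0 → ℝ}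

/-- **THE `H`-PART OF `RowsAt` (its first conjunct) FROM KERNEL ROWS + (162) + THE COMPARATOR**: `HKernelRows … dBI w flatH C δ`, `RowSum162 … dBI w δ₀ B₃` with
`δ₀/2 ≤ δ`, and `distBI ≤ dBI` give (46) `HSupLetterG` and (130) `HLapLetterG` at `max C (C·B₃)` and (161)₁ `HDecayLetterD` at `(max C (C·B₃), δ)` over that `dBI` —
i.e. the three `H`-letters of `RowsAt F n K D w (max C (C·B₃)) δ …` with the row sum read at the rate pair `(δ, B₃′)` the consumer chooses (here recorded with the
given `RowSum162 … δ₀ B₃`). [cite: Balaban1984PropagatorsII, Cor. 2.8 (2.150)-(2.151) p.249; Balaban1985Variational, (46) p.285, (130) p.298, (161)-(162) p.303] -/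
theorem hRows_of_kernelRows (hw : IsLevWeight F n K D w) (hDk : D.k = K - n) {dBI : PBond (F.P K) 0 → BondIdx D → ℝ} {C δ δ₀ B₃ : ℝ}
    (hC : 0 ≤ C) (hδ : δ₀ / 2 ≤ δ) (hcomp : ∀ b c, distBI D b c ≤ dBI b c)
    (hk : HKernelRows F n K D dBI w (flatH F n K D) C δ) (hrow : RowSum162 F n K D dBI w δ₀ B₃) :
    HSupLetterG F n K D w (flatH F n K D) (max C (C * B₃)) ∧ HLapLetterG F n K D w (flatH F n K D) (max C (C * B₃)) ∧
      (∀ b c, distBI D b c ≤ dBI b c) ∧ RowSum162 F n K D dBI w δ₀ B₃ ∧ HDecayLetterD F n K D dBI w (flatH F n K D) (max C (C * B₃)) δ := by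
  have hd0 : ∀ b c, 0 ≤ dBI b c := fun b c => le_trans (by
    unfold distBI
    exact mul_nonneg (pow_nonneg (inv_nonneg.2 (Nat.cast_nonneg _)) _) (B5Prop12FieldsLattice.distSite_nonneg _ _)) (hcomp b c)
  refine ⟨FlatOpsLettersAssembly.hSupLetterG_mono (hSupLetterG_of_kernelRows hw hDk hC hδ hd0 hk hrow) (le_max_right _ _),
    FlatOpsLettersAssembly.hLapLetterG_mono (hLapLetterG_of_kernelRows hw hDk hC hδ hd0 hk hrow) (le_max_right _ _), hcomp, hrow,
    FlatOpsLettersAssembly.hDecayLetterD_mono (hDecayLetterD_of_kernelRows hw hk) (le_max_left _ _)⟩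

end Pack

end Summit.QuantumFields.YangMills.Theorems.FlatOpsHRowsFromKernels

end
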